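import Summits.ResolutionOfSingularities.ResolutionOfSingularities.Theorems.MarkedTransferCampaignW12SandwichTSharp
import Mathlib.RingTheory.Ideal.Maps
import HarnessLib

/-!
# [OURS · L1 W1.2] Frobenius-sandwich differential operators — the structural statement: `p^e`-th powers are
# constants, Frobenius-extended ideals are stable under EVERY sandwich operator, the no-unit criterion for the
# sandwich negative modules / `𝔗♭`, its sharpness schema, and the barrier line (seat res-L1-s12-pv-1)

LADDER-RESOLUTION rung L (rescue), cell `res-hironaka` (run/shared/lean/pub/res-hironaka/), RESCUE-SEED §1 slot
**W1.2** «FROBENIUS-SANDWICH DIFFERENTIAL OPERATORS: define the negative modules with Diff relative to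
`ρ^e(O_ξ) ⊂ O_ξ` … instead of absolute `Diff_Z`, so `p^k`-th powers are constants and `1` is not manufactured».
Objects: res-L1-type-o2's typed vocabulary `MarkedTransferCampaignW12SandwichTSharp.lean` (p461383, lane A 10/10):
`Campaign.sandwichDD / sandwichPTildeNeg / sandwichPNega` (= row 008's `S05NegativePart.DD / pTildeNeg / pNega` at the
base ring `K := ρ^e(O) = (iterateFrobenius O p e).range`, i.e. with the tree's Grothendieck-relative operators
`Resolution.IsDiffOpLE (ρ^e O) k`, EGA IV₄ 16.8), `Campaign.sandwichNegaBl / sandwichTSharp / sandwichTFlat`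
(Def 13.2 (105) / `∥·∥` on the sandwich family) and the two NO-UNIT `Prop`s `Campaign.SandwichNegaNoUnit`,
`Campaign.SandwichTFlatNoUnit`. Host (WAKE-s12 2026-08-26T19:35:37Z, SIZED-ASK-L §S-s12): MarkedTransfer
`--supports stmt-ResolutionOfSingularities-15522`; helper file, PROOFS ONLY (no new objects).

HONEST FRAMING. Nothing in this file is a statement of H. Hironaka's manuscript *Resolution of singularities in
positive characteristics* (2017-03-23, [Hironaka2017], lit key `paper:url-3343fd9e678b`); Def 5.1 / Eq. (36) (p.25
L31–L44), Rem 11.1 (p.63 L7–L14 «all the operators should be `ρ^ℓ(O)`-linear») and Def 13.2 (105) (p.67 L16–L19)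
are CANDIDATES [claim: Hironaka2017, status: under-review] that enter ONLY through the typed carriers named above and
through explicit hypotheses on an abstract family `P : ℕ → Ideal O` standing for `j ↦ ℘(E,j)`. No verdict on
GAP-LEDGER rows R01 / R04 / R08 is implied; kernel facts about the OURS re-based objects only. AI proof is weaker
than expert review; nothing here is progress on resolution of singularities in positive characteristic.

## What is proved (ring level, ANY commutative ring `O` of characteristic `p`, ANY `e`; all sorry-free)

* §1 «`p^e`-th powers are constants»: every sandwich operator `D` (an `ρ^e(O)`-linear endomorphism of `O`, in
  particular every member of `Diff_{O/ρ^e(O)}` of any order) satisfies `D (f^{p^e}·t) = f^{p^e}·D t` and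
  `[D, f^{p^e}] = 0` (`apply_pow_mul`, `commMul_pow_eq_zero`) — the shape of row 073's typed convention
  `S11CoordFree.IsRhoLinear` (Rem 11.1), here a CONSEQUENCE of the typing, not a hypothesis.
* §2 FROBENIUS-EXTENDED IDEALS ARE SANDWICH-STABLE: if `Q = Ideal.span S` with `S ⊆ ρ^e(O)` (e.g. a Frobenius power
  `M^{[p^e]} = M.map (iterateFrobenius O p e)`), then `D(Q) ⊆ Q` for EVERY `ρ^e(O)`-linear `D`, of ANY order
  (`apply_mem_span_of_subset_range`), hence `Diff^{(k)}_{O/ρ^e(O)}·I ⊆ Q` whenever `I ⊆ Q` (`diffIdeal_le_span`). The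
  order filtration plays no role: relative to the sandwich the no-unit question is decided by linearity alone.
* §3 THE NO-UNIT CRITERION: `℘(E,j) ⊆ Q` for all `j > 0` ⇒ every `sandwichDD`, every `sandwichPTildeNeg … a` (ALL
  `a ∈ ℤ`, not only `a ≥ 0`) and every `sandwichPNega … a` lies in `Q` (`sandwichPTildeNeg_le_span` …); so `1 ∉ Q` ⇒
  `Campaign.SandwichNegaNoUnit p e P m` (`sandwichNegaNoUnit_of_span`); Frobenius-power form
  `sandwichNegaNoUnit_of_le_frobeniusPower` (`℘(E,j) ⊆ M^{[p^e]}`, `M ≠ O`). This is the structural content of the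
  slot's lever «`1` is not manufactured»; res-L1-k12's registered «box criterion» (K1.2, STATUS 19:41:04Z) is the case
  `Q = 𝔪_ξ^{[q]}`.
* §4 THE `𝔗♭` FORM: if moreover `℘posi ⊂ Bl(Z)` is fed by the same graded family (`pposi ≤ idealFamilyToBl …`), then
  `sandwichTFlat … ≤ Q` and `1 ∉ Q` ⇒ `Campaign.SandwichTFlatNoUnit` (`sandwichTFlatNoUnit_of_span`), for every
  `L0inf` (`∥a·T^d∥ = a`, `forgetDeg_C_mul_T`; `∥idealFamilyToBl N∥ ⊆ Q` when all `N i ⊆ Q`).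
* §5 SHARPNESS SCHEMA (what the sandwich can NOT do): an element `f ∈ ℘(E,dm)` and a sandwich operator of order
  `≤ dm + a` with `D f ∉ M` force `¬ sandwichPNega … a ≤ M` (`not_sandwichPNega_le`), and a unit value gives
  `sandwichPNega … a = ⊤` (`sandwichPNega_eq_top_of_isUnit`); and at a (37)-point the hypothesis of §3 with
  `Q ⊆ M^{p^e}` forces `p^e ≤ m` (`pow_le_of_le_frobeniusPower`) — the level `e` is tied to Def 5.1's `m`, the
  absolute collapse (res-adj-1, `ledger/evidence/R01/res-adj-1-G1Collapse.lean`) being the case `e = 0`.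

## BARRIER LINE (RESCUE-SEED W1.2: `FrobeniusTwistResolution.*`) — what the quotient step may NOT claim

`Literature.Barriers.ResolutionOfSingularities.FrobeniusTwistResolution` /
`….not_hasResolution_Spec_frobTwist` (Liu 2002 Ex. 3.2.12, proved in the tree): `Scheme.HasResolution` — and
regularity — do NOT transport across a Frobenius sandwich `ρ(O) ⊂ O` / a finite universal homeomorphism, in either
direction (`Spec K` regular, its Frobenius twist `Spec k[x]/((x−t)^p)` non-reduced with no resolution). Consequently
NOTHING in this file may be read as: «the sandwich negative modules are proper, hence some quotient / descent /
`ρ^e(O)`-level object is regular or resolvable, hence `O` is». The theorems below are statements about IDEAL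
MEMBERSHIP in `O` itself (no unit is manufactured by `ρ^e(O)`-linear operators out of a Frobenius-extended proper
ideal); any later use of `SandwichNegaNoUnit` / `SandwichTFlatNoUnit` toward termination or regularity must produce
its invariant ON `O` (or on the blown-up `O'`), never by transfer through `ρ^e`. The slot's campaign statement
`CampaignW12SandwichTSharpNoUnit` (res-L1-s12-plan-1, not yet filed at the time of writing) inherits this caveat.
-/

noncomputable section

set_option linter.dupNamespace false -- mandated namespace of this single-conjunct summit

namespace Summit.ResolutionOfSingularities.ResolutionOfSingularities.Theorems.Campaign.W12

open LaurentPolynomial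
open Literature.AlgebraicGeometry.Resolution
open Literature.AlgebraicGeometry.Hironaka2017
open Literature.AlgebraicGeometry.Hironaka2017.S11CoordFree (BlSub inDegree)
open Literature.AlgebraicGeometry.Hironaka2017.S12GLUED (forgetDeg fnorm)
open Summit.ResolutionOfSingularities.ResolutionOfSingularities.Theorems.Campaign

universe v

variable {O : Type v} [CommRing O] {p : ℕ} [Fact p.Prime] [CharP O p]

/-! ## §1 `p^e`-th powers are constants for every sandwich operator -/

/-- `f^{p^e}` lies in the sandwich base `ρ^e(O) = (iterateFrobenius O p e).range` (witness `f`). [folklore] -/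
theorem pow_mem_range (e : ℕ) (f : O) : f ^ p ^ e ∈ (iterateFrobenius O p e).range :=
  ⟨f, iterateFrobenius_def p e f⟩

/-- **«`p^e`-th powers are constants».** Every `ρ^e(O)`-linear endomorphism `D` of `O` — in particular every
differential operator of `O` RELATIVE TO `ρ^e(O)` of any order (`Resolution.IsDiffOpLE (ρ^e O) k D`, EGA IV₄ 16.8;
the operators of the typed `Campaign.sandwichDD`) — commutes with multiplication by `p^e`-th powers:
`D (f^{p^e}·t) = f^{p^e}·D t`. This is the shape of Rem 11.1's convention «all the operators should be
`ρ^ℓ(O)`-linear» (row 073 `S11CoordFree.IsRhoLinear`), obtained here from the typing. [folklore] -/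
theorem apply_pow_mul (e : ℕ) (D : O →ₗ[↥(iterateFrobenius O p e).range] O) (f t : O) :
    D (f ^ p ^ e * t) = f ^ p ^ e * D t := by
  have h : f ^ p ^ e * t = (⟨f ^ p ^ e, pow_mem_range e f⟩ : ↥(iterateFrobenius O p e).range) • t := rfl
  rw [h, map_smul]
  rfl

/-- `D (f^{p^e}) = f^{p^e}·D 1`: on `p^e`-th powers a sandwich operator is multiplication by the constant `D 1`.
[folklore] -/
theorem apply_pow (e : ℕ) (D : O →ₗ[↥(iterateFrobenius O p e).range] O) (f : O) :
    D (f ^ p ^ e) = f ^ p ^ e * D 1 := by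
  simpa using apply_pow_mul e D f 1

/-- Commutator form: `[D, f^{p^e}] = 0` for every sandwich operator `D` (tree `Resolution.commMul`), so `f^{p^e}`
never lowers the Grothendieck order of `D` relative to `ρ^e(O)` — contrast `[∂^{(p^e)}, x^{p^e}] ∋ 1` for the
ABSOLUTE operators behind the R01 collapse. [folklore] -/
theorem commMul_pow_eq_zero (e : ℕ) (D : O →ₗ[↥(iterateFrobenius O p e).range] O) (f : O) :
    commMul (↥(iterateFrobenius O p e).range) D (f ^ p ^ e) = 0 := by
  ext t
  rw [commMul_apply, apply_pow_mul, sub_self, LinearMap.zero_apply]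

/-! ## §2 Frobenius-extended ideals are stable under every sandwich operator -/

/-- **Sandwich stability of Frobenius-extended ideals.** If `Q = Ideal.span S` is generated by elements of the
sandwich base `ρ^e(O)` (`S ⊆ range (iterateFrobenius O p e)`), then EVERY `ρ^e(O)`-linear endomorphism `D` of `O`
maps `Q` into `Q` — whatever its order: `D (Σ oᵢ sᵢ) = Σ sᵢ D(oᵢ) ∈ Q`. [folklore] -/
theorem apply_mem_span_of_subset_range (e : ℕ) {S : Set O} (hS : S ⊆ Set.range (iterateFrobenius O p e))
    (D : O →ₗ[↥(iterateFrobenius O p e).range] O) {f : O} (hf : f ∈ Ideal.span S) :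
    D f ∈ Ideal.span S := by
  suffices h : ∀ o : O, D (o * f) ∈ Ideal.span S by simpa using h 1
  refine Submodule.span_induction (p := fun x _ => ∀ o : O, D (o * x) ∈ Ideal.span S) ?_ ?_ ?_ ?_ hf
  · intro s hs o
    obtain ⟨r, hr⟩ := hS hs
    have hmul : o * s = (⟨s, r, hr⟩ : ↥(iterateFrobenius O p e).range) • o := by
      change o * s = s * o
      exact mul_comm o s
    rw [hmul, map_smul]
    change s * D o ∈ Ideal.span S
    exact Ideal.mul_mem_right _ _ (Ideal.subset_span hs)
  · intro o
    rw [mul_zero, map_zero]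
    exact zero_mem _
  · intro x y _ _ hx hy o
    rw [mul_add, map_add]
    exact add_mem (hx o) (hy o)
  · intro a x _ hx o
    rw [smul_eq_mul, ← mul_assoc]
    exact hx (o * a)

/-- Hence `Diff^{(k)}_{O/ρ^e(O)}·I ⊆ Q` for every order `k` as soon as `I ⊆ Q = span S`, `S ⊆ ρ^e(O)` (tree
`Resolution.diffIdeal` at the base ring `ρ^e(O)`). [folklore] -/
theorem diffIdeal_le_span (e k : ℕ) {S : Set O} (hS : S ⊆ Set.range (iterateFrobenius O p e)) {I : Ideal O}
    (hI : I ≤ Ideal.span S) : diffIdeal (↥(iterateFrobenius O p e).range) k I ≤ Ideal.span S :=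
  (diffIdeal_le_iff _).mpr fun D _ _ hf => apply_mem_span_of_subset_range e hS D (hI hf)

/-- The Frobenius power `M^{[p^e]} := M.map (iterateFrobenius O p e) = span {x^{p^e} : x ∈ M}` is generated by
elements of `ρ^e(O)` (Mathlib: `Ideal.map f I = span (f '' I)` by definition). [folklore] -/
theorem map_iterateFrobenius_eq_span (e : ℕ) (M : Ideal O) :
    M.map (iterateFrobenius O p e) = Ideal.span (iterateFrobenius O p e '' (M : Set O)) :=
  rfl

/-- … and its generating set lies in `range (iterateFrobenius O p e)`. [folklore] -/
theorem image_subset_range_iterateFrobenius (e : ℕ) (M : Ideal O) :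
    iterateFrobenius O p e '' (M : Set O) ⊆ Set.range (iterateFrobenius O p e) :=
  Set.image_subset_range _ _

/-- `M^{[p^e]} ⊆ M^{p^e}` (each generator `x^{p^e}`, `x ∈ M`, lies in `M^{p^e}`). [folklore] -/
theorem map_iterateFrobenius_le_pow (e : ℕ) (M : Ideal O) : M.map (iterateFrobenius O p e) ≤ M ^ p ^ e := by
  refine Ideal.span_le.mpr ?_
  rintro _ ⟨x, hx, rfl⟩
  rw [iterateFrobenius_def]
  exact Ideal.pow_mem_pow hx _

/-- `M^{[p^e]} ⊆ M` (`p^e ≥ 1`). [folklore] -/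
theorem map_iterateFrobenius_le (e : ℕ) (M : Ideal O) : M.map (iterateFrobenius O p e) ≤ M :=
  (map_iterateFrobenius_le_pow e M).trans (Ideal.pow_le_self (pow_ne_zero e (Fact.out : p.Prime).ne_zero))

/-- Sandwich stability of Frobenius powers: `D(M^{[p^e]}) ⊆ M^{[p^e]}` for every `ρ^e(O)`-linear `D`. [folklore] -/
theorem apply_mem_map_iterateFrobenius (e : ℕ) (M : Ideal O) (D : O →ₗ[↥(iterateFrobenius O p e).range] O)
    {f : O} (hf : f ∈ M.map (iterateFrobenius O p e)) : D f ∈ M.map (iterateFrobenius O p e) :=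
  apply_mem_span_of_subset_range e (image_subset_range_iterateFrobenius e M) D hf

/-! ## §3 The sandwich negative modules under a Frobenius-extended bound; the no-unit criterion -/

section NoUnit

variable (p)

/-- Each re-based summand `D(m,a,d) = Diff^{(dm+a)}_{O/ρ^e(O)}·℘posi(E,dm)` (`Campaign.sandwichDD`) lies in `Q = span S`,
`S ⊆ ρ^e(O)`, as soon as `℘(E,j) ⊆ Q` for every `j > 0` (`℘posi(E,0) = 0` covers `dm = 0`); for ALL `a d ∈ ℤ`.
[folklore] -/
theorem sandwichDD_le_span (e : ℕ) {S : Set O} (hS : S ⊆ Set.range (iterateFrobenius O p e)) {P : ℕ → Ideal O}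
    (hP : ∀ j, 0 < j → P j ≤ Ideal.span S) (m : ℕ) (a d : ℤ) : sandwichDD p e P m a d ≤ Ideal.span S := by
  unfold sandwichDD S05NegativePart.DD
  refine diffIdeal_le_span e _ hS ?_
  unfold S05NegativePart.pPosi
  split_ifs with h
  · exact bot_le
  · exact hP _ (Nat.pos_of_ne_zero h)

/-- **All re-based pieces `℘̃_sandwich(E,−a)`, `a ∈ ℤ` (positive, zero AND negative), lie in `Q`** under the bound
`℘(E,j) ⊆ Q` (`j > 0`), `Q = span S`, `S ⊆ ρ^e(O)`. [folklore] -/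
theorem sandwichPTildeNeg_le_span (e : ℕ) {S : Set O} (hS : S ⊆ Set.range (iterateFrobenius O p e))
    {P : ℕ → Ideal O} (hP : ∀ j, 0 < j → P j ≤ Ideal.span S) (m : ℕ) (a : ℤ) :
    sandwichPTildeNeg p e P m a ≤ Ideal.span S := by
  unfold sandwichPTildeNeg S05NegativePart.pTildeNeg
  exact iSup₂_le fun d _ => sandwichDD_le_span p e hS hP m a d

/-- The sandwich negative modules `℘nega_sandwich(E,−a)`, `a : ℕ`, lie in `Q`. [folklore] -/
theorem sandwichPNega_le_span (e : ℕ) {S : Set O} (hS : S ⊆ Set.range (iterateFrobenius O p e))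
    {P : ℕ → Ideal O} (hP : ∀ j, 0 < j → P j ≤ Ideal.span S) (m a : ℕ) :
    sandwichPNega p e P m a ≤ Ideal.span S :=
  sandwichPTildeNeg_le_span p e hS hP m (a : ℤ)

/-- **NO-UNIT CRITERION (the structural form of the slot's lever «`1` is not manufactured»).** If every positive
piece `℘(E,j)`, `j > 0`, lies in an ideal `Q = span S` generated by `p^e`-th powers (`S ⊆ ρ^e(O)`) with `1 ∉ Q`, then
`Campaign.SandwichNegaNoUnit p e P m`: no sandwich negative module contains `1`, for any `m`. [folklore] -/
theorem sandwichNegaNoUnit_of_span (e : ℕ) {S : Set O} (hS : S ⊆ Set.range (iterateFrobenius O p e))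
    (h1 : (1 : O) ∉ Ideal.span S) {P : ℕ → Ideal O} (hP : ∀ j, 0 < j → P j ≤ Ideal.span S) (m : ℕ) :
    SandwichNegaNoUnit p e P m :=
  fun a _ ha1 => h1 (sandwichPNega_le_span p e hS hP m a ha1)

/-- Frobenius-power form of the bound: `℘(E,j) ⊆ M^{[p^e]}` (`j > 0`) ⇒ `℘nega_sandwich(E,−a) ⊆ M^{[p^e]} ⊆ M`.
[folklore] -/
theorem sandwichPNega_le_of_le_frobeniusPower (e : ℕ) (M : Ideal O) {P : ℕ → Ideal O}
    (hP : ∀ j, 0 < j → P j ≤ M.map (iterateFrobenius O p e)) (m a : ℕ) :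
    sandwichPNega p e P m a ≤ M.map (iterateFrobenius O p e) ∧ sandwichPNega p e P m a ≤ M :=
  have h := sandwichPNega_le_span p e (image_subset_range_iterateFrobenius e M) hP m a
  ⟨h, h.trans (map_iterateFrobenius_le e M)⟩

/-- **No unit from a Frobenius power of a proper ideal**: `M ≠ O`, `℘(E,j) ⊆ M^{[p^e]}` for `j > 0` ⇒
`Campaign.SandwichNegaNoUnit p e P m` (res-L1-k12's «box criterion» of K1.2 is `M = 𝔪_ξ`, `p^e = q`). [folklore] -/
theorem sandwichNegaNoUnit_of_le_frobeniusPower (e : ℕ) {M : Ideal O} (hM : M ≠ ⊤) {P : ℕ → Ideal O}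
    (hP : ∀ j, 0 < j → P j ≤ M.map (iterateFrobenius O p e)) (m : ℕ) : SandwichNegaNoUnit p e P m :=
  fun a _ ha1 => hM ((Ideal.eq_top_iff_one M).mpr ((sandwichPNega_le_of_le_frobeniusPower p e M hP m a).2 ha1))

end NoUnit

/-! ## §4 The `𝔗♭` form -/

/-- `∥a·T^d∥ = a` (row 076's `forgetDeg`). [folklore] -/
theorem forgetDeg_C_mul_T {R : Type*} [CommSemiring R] [Module R O] (a : O) (d : ℤ) :
    forgetDeg R O (C a * T d) = a := by
  have hc : (C a * T d).coeff = Finsupp.single d a := by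
    rw [← single_eq_C_mul_T, AddMonoidAlgebra.coeff_single]
  simp [forgetDeg, hc, Finsupp.sum_single_index]

/-- `∥inDegree d N∥ ⊆ N`: forgetting the degree of `N·T^d` returns (a subset of) `N`. [folklore] -/
theorem fnorm_inDegree_le {ℓ : ℕ} (d : ℤ) (N : Submodule (↥(iterateFrobenius O p ℓ).range) O) :
    fnorm (↥(iterateFrobenius O p ℓ).range) (inDegree (p := p) d N) ≤ N := by
  unfold fnorm inDegree
  rw [Submodule.map_span, Submodule.span_le]
  rintro _ ⟨_, ⟨a, ha, rfl⟩, rfl⟩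
  simpa [forgetDeg_C_mul_T] using ha

/-- `∥idealFamilyToBl N∥ ⊆ Q` when every `N i ⊆ Q` (`Campaign.idealFamilyToBl` = `⨆_i inDegree i (N i)`). [folklore] -/
theorem fnorm_idealFamilyToBl_le {ℓ : ℕ} (N : ℤ → Ideal O) (Q : Ideal O) (hN : ∀ i, N i ≤ Q) :
    fnorm (↥(iterateFrobenius O p ℓ).range) (idealFamilyToBl (p := p) (ℓ := ℓ) N) ≤
      Q.restrictScalars (↥(iterateFrobenius O p ℓ).range) := by
  unfold fnorm idealFamilyToBl
  rw [Submodule.map_iSup]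
  refine iSup_le fun i => ?_
  refine (fnorm_inDegree_le (p := p) i _).trans ?_
  intro x hx
  exact hN i hx

section TFlat

variable (p)

/-- The sandwich `℘nega ⊂ Bl(Z)` has `∥·∥ ⊆ Q` under the bound of §3. [folklore] -/
theorem fnorm_sandwichNegaBl_le (ℓ e : ℕ) {S : Set O} (hS : S ⊆ Set.range (iterateFrobenius O p e))
    {P : ℕ → Ideal O} (hP : ∀ j, 0 < j → P j ≤ Ideal.span S) (m : ℕ) :
    fnorm (↥(iterateFrobenius O p ℓ).range) (sandwichNegaBl (p := p) ℓ e P m) ≤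
      (Ideal.span S).restrictScalars (↥(iterateFrobenius O p ℓ).range) := by
  unfold sandwichNegaBl
  refine fnorm_idealFamilyToBl_le _ _ fun i => ?_
  split_ifs
  · exact sandwichPNega_le_span p e hS hP m _
  · exact bot_le

/-- **`𝔗♭_sandwich ⊆ Q`.** With `℘posi ⊂ Bl(Z)` fed by the same graded family in positive degrees
(`pposi ≤ idealFamilyToBl (i ↦ ℘(E,i) for i > 0, else 0)`), the bound `℘(E,j) ⊆ Q = span S` (`j > 0`, `S ⊆ ρ^e(O)`)
gives `sandwichTFlat ℓ e L0inf pposi P m ⊆ Q` for EVERY `L0inf` («𝔏_0(∞)»). [folklore] -/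
theorem sandwichTFlat_le_span (ℓ e : ℕ) {S : Set O} (hS : S ⊆ Set.range (iterateFrobenius O p e))
    {P : ℕ → Ideal O} (hP : ∀ j, 0 < j → P j ≤ Ideal.span S) (L0inf pposi : BlSub O p ℓ)
    (hposi : pposi ≤ idealFamilyToBl (p := p) fun i : ℤ => if 0 < i then P i.toNat else ⊥) (m : ℕ) :
    sandwichTFlat ℓ e L0inf pposi P m ≤ (Ideal.span S).restrictScalars (↥(iterateFrobenius O p ℓ).range) := by
  unfold sandwichTFlat S13GLUEDDiagram.TFlat S13GLUEDDiagram.TSharp fnorm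
  rw [Submodule.map_sup]
  refine sup_le ?_ (fnorm_sandwichNegaBl_le p ℓ e hS hP m)
  refine (Submodule.map_mono (inf_le_right.trans hposi)).trans ?_
  refine fnorm_idealFamilyToBl_le _ _ fun i => ?_
  split_ifs with hi
  · exact hP _ (by omega)
  · exact bot_le

/-- **NO-UNIT CRITERION, `𝔗♭` form**: under the hypotheses of `sandwichTFlat_le_span` and `1 ∉ Q`,
`Campaign.SandwichTFlatNoUnit ℓ e L0inf pposi P m` («`𝔗♯ ∌ 1`» read through `∥·∥`, RESCUE-SEED W1.2's question).
[folklore] -/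
theorem sandwichTFlatNoUnit_of_span (ℓ e : ℕ) {S : Set O} (hS : S ⊆ Set.range (iterateFrobenius O p e))
    (h1 : (1 : O) ∉ Ideal.span S) {P : ℕ → Ideal O} (hP : ∀ j, 0 < j → P j ≤ Ideal.span S)
    (L0inf pposi : BlSub O p ℓ)
    (hposi : pposi ≤ idealFamilyToBl (p := p) fun i : ℤ => if 0 < i then P i.toNat else ⊥) (m : ℕ) :
    SandwichTFlatNoUnit ℓ e L0inf pposi P m :=
  fun h => h1 (sandwichTFlat_le_span p ℓ e hS hP L0inf pposi hposi m h)

/-- Frobenius-power form: `M ≠ O`, `℘(E,j) ⊆ M^{[p^e]}` (`j > 0`), `℘posi` fed by the family ⇒ `1 ∉ 𝔗♭_sandwich`.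
[folklore] -/
theorem sandwichTFlatNoUnit_of_le_frobeniusPower (ℓ e : ℕ) {M : Ideal O} (hM : M ≠ ⊤) {P : ℕ → Ideal O}
    (hP : ∀ j, 0 < j → P j ≤ M.map (iterateFrobenius O p e)) (L0inf pposi : BlSub O p ℓ)
    (hposi : pposi ≤ idealFamilyToBl (p := p) fun i : ℤ => if 0 < i then P i.toNat else ⊥) (m : ℕ) :
    SandwichTFlatNoUnit ℓ e L0inf pposi P m :=
  sandwichTFlatNoUnit_of_span p ℓ e (image_subset_range_iterateFrobenius e M)
    (fun h => hM ((Ideal.eq_top_iff_one M).mpr (map_iterateFrobenius_le e M h))) hP L0inf pposi hposi m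

end TFlat

/-! ## §5 Sharpness: what the sandwich does NOT prevent; the level `e` versus Def 5.1's `m` -/

section Sharp

variable (p)

/-- Values of sandwich operators of order `≤ dm + a` on `℘(E,dm)` (`dm ≠ 0`, `a ≤ dm`) lie in
`℘nega_sandwich(E,−a)` — the summand `d` of Eq. (36) re-based. [folklore] -/
theorem apply_mem_sandwichPNega (e : ℕ) (P : ℕ → Ideal O) (m a d : ℕ) (had : a ≤ d * m) (hdm : d * m ≠ 0)
    {D : O →ₗ[↥(iterateFrobenius O p e).range] O} (hD : IsDiffOpLE (↥(iterateFrobenius O p e).range) (d * m + a) D)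
    {f : O} (hf : f ∈ P (d * m)) : D f ∈ sandwichPNega p e P m a := by
  unfold sandwichPNega S05NegativePart.pNega S05NegativePart.pTildeNeg
  have hdm' : |(a : ℤ)| ≤ (d : ℤ) * m := by
    rw [Nat.abs_cast]; exact_mod_cast had
  refine (le_iSup₂ (f := fun (d : ℤ) (_ : |(a : ℤ)| ≤ d * m) =>
    S05NegativePart.DD (↥(iterateFrobenius O p e).range) P m a d) (d : ℤ) hdm') ?_
  unfold S05NegativePart.DD
  have h1 : ((d : ℤ) * m).toNat = d * m := by
    rw [show ((d : ℤ) * m) = ((d * m : ℕ) : ℤ) by push_cast; ring, Int.toNat_natCast]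
  have h2 : ((d : ℤ) * m + a).toNat = d * m + a := by
    rw [show ((d : ℤ) * m + a) = ((d * m + a : ℕ) : ℤ) by push_cast; ring, Int.toNat_natCast]
  rw [h1, h2]
  have hpos : S05NegativePart.pPosi P (d * m) = P (d * m) := by simp [S05NegativePart.pPosi, hdm]
  rw [hpos]
  exact apply_mem_diffIdeal _ hD hf

/-- **Sharpness schema.** An element `f ∈ ℘(E,dm)` and a sandwich operator `D` of order `≤ dm + a` with `D f ∉ M`
witness `¬ ℘nega_sandwich(E,−a) ⊆ M` (res-L1-k12's DEAD-type certificate shape; e.g. a box monomial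
`x^γ`, `γ_i < p^e`, `|γ| ≤ dm + a`, with unit coefficient in `f`, and `D = ∂^{(γ)}`). [folklore] -/
theorem not_sandwichPNega_le (e : ℕ) (P : ℕ → Ideal O) (m a d : ℕ) (had : a ≤ d * m) (hdm : d * m ≠ 0)
    {D : O →ₗ[↥(iterateFrobenius O p e).range] O} (hD : IsDiffOpLE (↥(iterateFrobenius O p e).range) (d * m + a) D)
    {f : O} (hf : f ∈ P (d * m)) (M : Ideal O) (hDf : D f ∉ M) : ¬ sandwichPNega p e P m a ≤ M :=
  fun h => hDf (h (apply_mem_sandwichPNega p e P m a d had hdm hD hf))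

/-- … and a UNIT value collapses the module: `℘nega_sandwich(E,−a) = O`. [folklore] -/
theorem sandwichPNega_eq_top_of_isUnit (e : ℕ) (P : ℕ → Ideal O) (m a d : ℕ) (had : a ≤ d * m)
    (hdm : d * m ≠ 0) {D : O →ₗ[↥(iterateFrobenius O p e).range] O}
    (hD : IsDiffOpLE (↥(iterateFrobenius O p e).range) (d * m + a) D) {f : O} (hf : f ∈ P (d * m))
    (hu : IsUnit (D f)) : sandwichPNega p e P m a = ⊤ :=
  Ideal.eq_top_of_isUnit_mem _ (apply_mem_sandwichPNega p e P m a d had hdm hD hf) hu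

/-- **The level `e` is tied to `m`.** If the (37)-element `g ∈ ℘(E,m)` has `g ∉ M^{m+1}` (order exactly `m` at the
point with ideal `M`) and `℘(E,m) ⊆ M^{[p^e]}` (the hypothesis of §3 at `j = m`), then `p^e ≤ m`: the Frobenius
level of the sandwich cannot exceed Def 5.1's `m` at a (37)-point (and `e = 0`, `ρ^0(O) = O`, is the absolute
case of the R01 collapse). [folklore] -/
theorem pow_le_of_le_frobeniusPower (e m : ℕ) (M : Ideal O) {P : ℕ → Ideal O}
    (hP : P m ≤ M.map (iterateFrobenius O p e)) {g : O} (hg : g ∈ P m) (hgM : g ∉ M ^ (m + 1)) :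
    p ^ e ≤ m := by
  by_contra h
  have hle : M ^ p ^ e ≤ M ^ (m + 1) := Ideal.pow_le_pow_right (by omega)
  exact hgM (hle (map_iterateFrobenius_le_pow e M (hP hg)))

end Sharp

end Summit.ResolutionOfSingularities.ResolutionOfSingularities.Theorems.Campaign.W12

end
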